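import Summits.QuantumFields.YangMills.Theorems.BalabanUVNodesN15KingModelTorusPlaneWaves
import HarnessLib

/-!
# BalabanUVNodes ∕ N15 — THE KING-MODEL RUNG (PART Ε-k): THE FREE DETERMINANT ON THE TORUS IN CLOSED FORM —
# `det(c(−Δ)+m²)_{Π_μℤ∕K_μ} = Π_{q∈Ω̂} (m² + cΣ_μ(2 − 2cos p′_μ(q)))`, `log det = Σ_q log lapSym(q)`, `|Ω|·log m² ≤ log det ≤ |Ω|·log(m² + 4c(d+1))`
# (Track A, DAG node N15 = NE2; FAN-OUT v1.1 §N15 s3 «KING-MODEL RUNG»; King (3.89) «ln N_k = −½ ln det» — the determinant half, for the fine free action; count-neutral)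

HONEST FRAMING.  Count-neutral (cell `pub-ymgap`, seat `pub-ymgap-dag-n15-e` g40; `--supports stmt-QuantumFields-27366 --as helper` = K3⁸).
TEMPLATE LITERATURE: C. King, Commun. Math. Phys. **102** (1986) 649–677 [King1986], (2.6) p.652 and (3.89)–(3.93) pp.668–669 (the Gaussian normalisations `N_k` of the
effective actions, `ln N_k = −½ ln det` of the quadratic forms), (4.4) p.670 (the symbol of `c(−Δ)+m²`), (4.35) p.674 (plane waves); [Balaban1984PropagatorsI] (1.29) p.23
(the dual torus).  This lineage typed King's normalisations DETERMINANT-FREE (part Τ-b `…FreeRGGaussNorm`: «the tree has no multi-dimensional Gaussian-integral ∕ determinant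
formula», «Gaussian normalisation = −½ log det … NOT derived»).  THIS FILE supplies the determinant of the FINE FREE ACTION `½⟨φ,(c(−Δ)+m²)φ⟩` on every torus in closed
form, by diagonalising King's `lapF` with the plane waves of part Ε-e (no Gaussian integral is evaluated here — the identification `N = (2π)^{|Ω|∕2}det^{−1∕2}` stays a door):
§1 `kingWaveMatrix K : Matrix (Tor K) (Tor K) ℂ`, `(x, q) ↦ e^{iq·x}` (the columns are the plane waves); ★ `lapF_map_mul_kingWaveMatrix` (`lapF·Φ = Φ·diag(lapSym)` — Ε-e's
`sum_lapF_mul_chi`); ★ `conjTranspose_kingWaveMatrix_mul` (`ΦᴴΦ = |Ω|·1` — character orthogonality `sum_chi`); `det_kingWaveMatrix_ne_zero`; §2 ★★★ **`det_lapF_eq_prod_lapSym`**: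
`det(lapF K c m²) = Π_{q∈Ω̂} lapSym K c m² q` on EVERY torus `Ω = Π_μℤ∕K_μ`, every `c, m² ∈ ℝ` (a polynomial identity: no sign condition); §3 for `c ≥ 0`, `m² > 0`:
★★ **`det_lapF_pos`**, ★★ **`log_det_lapF`** (`log det = Σ_q log lapSym(q)` — the free energy of the fine free field is the plane-wave sum), ★★ **`log_det_lapF_bounds`**
(`|Ω|·log m² ≤ log det ≤ |Ω|·log(m² + 4c(d+1))`: extensive, volume-uniform bounds), ★ `freeEnergyDensity_bounds` (per site: `log m² ≤ |Ω|⁻¹log det ≤ log(m² + 4c(d+1))`).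

PRIOR TREE ART (used, not restated): `King1986.EffectiveLaplacianSymbol` (`lapF`, `lapSym`, `lapSym_ge`), `B5Prop11Plancherel` (`chi`, `sum_chi`), `King1986.TorusBlockForm`
(`chi_mul_conj_chi_left`), part Ε-e (`sum_lapF_mul_chi`, `lapSym_le`).  NOT Bałaban's covariant objects; NOT a node discharge (N15 is booked through n15-a's knit, untouched);
nothing continuum-YM ∕ `ℝ⁴` ∕ OS ∕ Clay.  0 `sorry`; 1 `def` (`kingWaveMatrix`).

HONEST SCOPE.  Finite-dimensional linear algebra on every torus (any period vector, any `d`); §3 needs `c ≥ 0`, `m² > 0`.  The THERMODYNAMIC LIMIT of the free energy density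
`|Ω|⁻¹Σ_q log lapSym(q) → (2π)^{−(d+1)}∫_{[−π,π]^{d+1}} log(m² + cΣ(2−2cos p_μ))dp` (a Riemann sum of a continuous function) and the Gaussian-integral identity
`𝒩(lapF) = (2π)^{|Ω|∕2}(det lapF)^{−1∕2}` are NOT proved here (doors).  Locators: [King1986] (2.6) p.652, (3.89)–(3.93) pp.668–669, (4.4) p.670, (4.35) p.674;
[Balaban1984PropagatorsI] (1.29) p.23.
-/

noncomputable section

open scoped BigOperators ComplexConjugate
open Finset Complex Matrix

namespace Summit.QuantumFields.YangMills.BalabanUVNodes.N15KingModelRung.TorusSpectral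

open Literature.MathematicalPhysics.QuantumFieldTheory.Balaban1983to89.B5Prop11Plancherel (Tor chi sum_chi)
open Literature.MathematicalPhysics.QuantumFieldTheory.King1986.Torus

variable {d : ℕ} (K : Fin (d + 1) → ℕ) [hK : ∀ μ, NeZero (K μ)]

/-! ## §1 The plane-wave matrix diagonalises `c(−Δ)+m²` -/

/-- THE PLANE-WAVE MATRIX `Φ(x, q) = e^{iq·x}` of the torus `Π_μℤ∕K_μ` (columns = King's plane waves). [cite: King1986, (4.35) p.674; Balaban1984PropagatorsI, (1.29) p.23] -/
def kingWaveMatrix : Matrix (Tor K) (Tor K) ℂ := fun x q => chi K q x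

/-- ★ PLANE WAVES DIAGONALISE `c(−Δ)+m²`: `lapF·Φ = Φ·diag(lapSym)`. [cite: King1986, (4.4) p.670, (4.35) p.674] -/
theorem lapF_map_mul_kingWaveMatrix (c m2 : ℝ) :
    (lapF K c m2).map ((↑) : ℝ → ℂ) * kingWaveMatrix K = kingWaveMatrix K * Matrix.diagonal fun q => (lapSym K c m2 q : ℂ) := by
  ext x q
  rw [Matrix.mul_apply, Matrix.mul_diagonal]
  have h := sum_lapF_mul_chi K c m2 q x 0
  simp only [sub_zero] at h
  simpa [kingWaveMatrix, Matrix.map_apply, mul_comm] using h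

/-- ★ CHARACTER ORTHOGONALITY AS A MATRIX IDENTITY: `ΦᴴΦ = |Ω|·1`. [cite: King1986, (4.35) p.674; Balaban1984PropagatorsI, (1.29) p.23] -/
theorem conjTranspose_kingWaveMatrix_mul :
    (kingWaveMatrix K)ᴴ * kingWaveMatrix K = (Fintype.card (Tor K) : ℂ) • (1 : Matrix (Tor K) (Tor K) ℂ) := by
  ext q q'
  rw [Matrix.mul_apply, Matrix.smul_apply, Matrix.one_apply, smul_eq_mul]
  have e : ∀ x : Tor K, (kingWaveMatrix K)ᴴ q x * kingWaveMatrix K x q' = chi K (q' - q) x := fun x => by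
    rw [Matrix.conjTranspose_apply, kingWaveMatrix, kingWaveMatrix, Complex.star_def, mul_comm, chi_mul_conj_chi_left]
  simp_rw [e]
  rw [sum_chi K (q' - q)]
  by_cases h : q = q'
  · subst h; simp
  · rw [if_neg (fun h' => h (sub_eq_zero.mp h').symm), if_neg h, mul_zero]

/-- the plane-wave matrix is invertible: `det Φ ≠ 0` (`|det Φ|² = |Ω|^{|Ω|}`). [folklore] -/
theorem det_kingWaveMatrix_ne_zero : (kingWaveMatrix K).det ≠ 0 := by
  intro h0
  have h := congrArg Matrix.det (conjTranspose_kingWaveMatrix_mul K)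
  rw [Matrix.det_mul, h0, mul_zero, Matrix.det_smul, Matrix.det_one, mul_one] at h
  have hcard : (Fintype.card (Tor K) : ℂ) ≠ 0 := by exact_mod_cast Fintype.card_ne_zero
  exact pow_ne_zero _ hcard h.symm

/-! ## §2 The determinant in closed form -/

/-- ★★★ **THE FREE DETERMINANT ON THE TORUS**: `det(c(−Δ)+m²) = Π_{q∈Ω̂} (m² + cΣ_μ(2 − 2cos p′_μ(q)))` on every torus `Π_μℤ∕K_μ`, for all real `c, m²` (the eigenvalues of the
circulant `lapF` are the symbol values). [cite: King1986, (3.89) p.668, (4.4) p.670, (4.35) p.674; Balaban1984PropagatorsI, (1.29) p.23] -/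
theorem det_lapF_eq_prod_lapSym (c m2 : ℝ) : (lapF K c m2).det = ∏ q : Tor K, lapSym K c m2 q := by
  have hΦ := det_kingWaveMatrix_ne_zero K
  have h := congrArg Matrix.det (lapF_map_mul_kingWaveMatrix K c m2)
  rw [Matrix.det_mul, Matrix.det_mul, Matrix.det_diagonal, mul_comm] at h
  have hc : ((lapF K c m2).map ((↑) : ℝ → ℂ)).det = ∏ q : Tor K, (lapSym K c m2 q : ℂ) := mul_left_cancel₀ hΦ h
  have hmap : (((lapF K c m2).det : ℝ) : ℂ) = ((lapF K c m2).map ((↑) : ℝ → ℂ)).det := RingHom.map_det Complex.ofRealHom (lapF K c m2)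
  apply Complex.ofReal_injective
  rw [hmap, hc]
  push_cast
  rfl

/-! ## §3 Positivity, the free energy as a plane-wave sum, and volume-uniform bounds -/

variable {c m2 : ℝ}

/-- ★★ `det(c(−Δ)+m²) > 0` (`c ≥ 0`, `m² > 0`). [cite: King1986, (4.4) p.670] -/
theorem det_lapF_pos (hc : 0 ≤ c) (hm : 0 < m2) : 0 < (lapF K c m2).det := by
  rw [det_lapF_eq_prod_lapSym]
  exact Finset.prod_pos fun q _ => lt_of_lt_of_le hm (lapSym_ge K c m2 hc q)

/-- ★★ **THE FREE ENERGY IS THE PLANE-WAVE SUM**: `log det(c(−Δ)+m²) = Σ_{q∈Ω̂} log lapSym(q)`. [cite: King1986, (3.89) p.668, (4.4) p.670, (4.35) p.674] -/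
theorem log_det_lapF (hc : 0 ≤ c) (hm : 0 < m2) : Real.log (lapF K c m2).det = ∑ q : Tor K, Real.log (lapSym K c m2 q) := by
  rw [det_lapF_eq_prod_lapSym, Real.log_prod]
  exact fun q _ => (lt_of_lt_of_le hm (lapSym_ge K c m2 hc q)).ne'

/-- ★★ **EXTENSIVE, VOLUME-UNIFORM BOUNDS**: `|Ω|·log m² ≤ log det(c(−Δ)+m²) ≤ |Ω|·log(m² + 4c(d+1))` (`m² ≤ lapSym ≤ m² + 4c(d+1)`). [cite: King1986, (3.89)–(3.93) pp.668–669, (4.4) p.670] -/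
theorem log_det_lapF_bounds (hc : 0 ≤ c) (hm : 0 < m2) :
    (Fintype.card (Tor K) : ℝ) * Real.log m2 ≤ Real.log (lapF K c m2).det ∧
      Real.log (lapF K c m2).det ≤ (Fintype.card (Tor K) : ℝ) * Real.log (m2 + 4 * c * (d + 1)) := by
  rw [log_det_lapF K hc hm]
  constructor
  · calc (Fintype.card (Tor K) : ℝ) * Real.log m2 = ∑ _q : Tor K, Real.log m2 := by rw [Finset.sum_const, Finset.card_univ, nsmul_eq_mul]
      _ ≤ ∑ q : Tor K, Real.log (lapSym K c m2 q) := Finset.sum_le_sum fun q _ => Real.log_le_log hm (lapSym_ge K c m2 hc q)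
  · calc ∑ q : Tor K, Real.log (lapSym K c m2 q) ≤ ∑ _q : Tor K, Real.log (m2 + 4 * c * (d + 1)) :=
          Finset.sum_le_sum fun q _ => Real.log_le_log (lt_of_lt_of_le hm (lapSym_ge K c m2 hc q)) (lapSym_le K hc m2 q)
      _ = (Fintype.card (Tor K) : ℝ) * Real.log (m2 + 4 * c * (d + 1)) := by rw [Finset.sum_const, Finset.card_univ, nsmul_eq_mul]

/-- ★ **THE FREE ENERGY DENSITY IS BOUNDED UNIFORMLY IN THE VOLUME**: `log m² ≤ |Ω|⁻¹·log det(c(−Δ)+m²) ≤ log(m² + 4c(d+1))` on every torus. [cite: King1986, (3.89)–(3.93) pp.668–669] -/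
theorem freeEnergyDensity_bounds (hc : 0 ≤ c) (hm : 0 < m2) :
    Real.log m2 ≤ (Fintype.card (Tor K) : ℝ)⁻¹ * Real.log (lapF K c m2).det ∧
      (Fintype.card (Tor K) : ℝ)⁻¹ * Real.log (lapF K c m2).det ≤ Real.log (m2 + 4 * c * (d + 1)) := by
  have hcard : (0 : ℝ) < Fintype.card (Tor K) := by exact_mod_cast Fintype.card_pos
  obtain ⟨h1, h2⟩ := log_det_lapF_bounds K hc hm
  constructor
  · rw [le_inv_mul_iff₀ hcard]; exact h1
  · rw [inv_mul_le_iff₀ hcard]; exact h2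

end Summit.QuantumFields.YangMills.BalabanUVNodes.N15KingModelRung.TorusSpectral

end
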